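import Literature.MathematicalPhysics.QuantumFieldTheory.TorusChartFlatCochains
import HarnessLib

/-!
# The comb (axial-tree) gauge for arbitrary `1`-cochains on a charted torus

`TorusChartCochains.lean` / `TorusChartFlatCochains.lean` decompose a FLAT `1`-cochain as
`θ = d₀ (prim θ) + seam (wind θ)`.  For the vortex side of the spin-wave / vortex calculus (the regrouping
of integer bond fields `n` by gauge classes `n = d₀ m + a` in the Villain / Fröhlich–Spencer unfolding) one
needs the corresponding statement for ARBITRARY cochains, which is purely combinatorial: the edges of the
lexicographic axial staircases form a spanning tree of the torus (the **comb**), and every cochain is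
uniquely a gradient of a function vanishing at the origin plus a cochain vanishing on the comb.

* `TorusChart.IsCombEdge F x μ` — the comb edges: `x_ν = 0` for all `ν > μ` and `x_μ + 1 < N_μ`
  (the non-wrapping edges of the staircases);
* `TorusChart.axPrim_add_gen_of_comb`, `TorusChart.d₀_prim_of_isCombEdge` — **the axial primitive
  integrates every cochain on the comb**: `d₀ (prim θ) (x, μ) = θ (x, μ)` on comb edges, with NO
  flatness assumption (compare `d₀_prim_of_lt`);
* `TorusChart.prim_eq_zero_of_comb` — a cochain vanishing on the comb has zero axial primitive (the
  staircases run along comb edges);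
* `TorusChart.combRep θ = θ - d₀ (prim θ)`, the comb-gauge representative of the gauge class of `θ`; it
  vanishes on the comb (`combRep_of_isCombEdge`), has the curl of `θ` (`d₁_combRep`), and
  `θ = d₀ (prim θ) + combRep θ` (`d₀_prim_add_combRep`);
* **uniqueness** `TorusChart.eq_prim_and_eq_combRep`: if `θ = d₀ f + ρ` with `f 0 = 0` and `ρ` vanishing
  on the comb then `f = prim θ` and `ρ = combRep θ`; packaged as the additive equivalence
  `TorusChart.combEquiv : (Λ → Fin d → A) ≃+ {f : Λ → A // f 0 = 0} × {ρ // ρ vanishes on the comb}`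
  (the bijection along which sums over integer bond fields are regrouped, `Equiv.hasSum_iff`);
* **labelling of gauge classes** `TorusChart.combRep_eq_combRep_iff`: two cochains have the same comb
  representative iff they have the same curl `d₁` and the same winding vector `wind`; packaged as
  `TorusChart.sectorEquiv : combVanishing ≃+ curlImage × (Fin d → A)`, `ρ ↦ (d₁ ρ, wind ρ)` with inverse
  `TorusChart.sectorRep` (vortex configuration plus global holonomies label the sectors).

Everything is proved; no named fact is introduced.

## References

* J. Fröhlich, T. Spencer, Comm. Math. Phys. 81 (1981) 527–602, §3 (gauge classes of integer bond
  variables ↔ vortex configurations). [folklore form]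
-/

namespace Literature.MathematicalPhysics.QuantumFieldTheory

open scoped BigOperators

namespace TorusChart

variable {Λ : Type*} [AddCommGroup Λ] {d : ℕ} (F : TorusChart Λ d)

/-! ## Comb edges -/

/-- The **comb edges** of a charted torus: the edge `(x, μ)` lies on the comb (the union of all lexicographic
axial staircases from the origin) iff the coordinates of `x` beyond direction `μ` vanish and the edge does not
wrap (`x_μ + 1 < N_μ`). [folklore] -/
def IsCombEdge (x : Λ) (μ : Fin d) : Prop :=
  (∀ ν : Fin d, μ < ν → F.cval ν x = 0) ∧ F.cval μ x + 1 < F.period μ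

/-- The edges of the `κ`-leg of a staircase are comb edges: if the coordinates of `y` beyond `κ` vanish,
`y_κ = 0` and `j + 1 < N_κ`, then `(y + j • e_κ, κ)` is a comb edge. [folklore] -/
theorem isCombEdge_add_nsmul_gen {y : Λ} {κ : Fin d} (hy : ∀ ν : Fin d, κ < ν → F.cval ν y = 0)
    (hy0 : F.cval κ y = 0) {j : ℕ} (hj : j + 1 < F.period κ) : F.IsCombEdge (y + j • F.gen κ) κ := by
  refine ⟨fun ν hν => ?_, ?_⟩
  · rw [F.cval_add_nsmul_gen_of_ne (ne_of_lt hν).symm, hy ν hν]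
  · rw [F.cval_add_nsmul_gen_self, hy0, zero_add, Nat.mod_eq_of_lt (lt_trans (Nat.lt_succ_self j) hj)]
    exact hj

variable {A : Type*} [AddCommGroup A]

/-! ## The axial primitive integrates every cochain on the comb -/

/-- **Axial primitive across a comb edge (no flatness).** For a comb edge `(x, μ)` and ANY `1`-cochain `θ`,
after `k` directions the staircase sum towards `x + e_μ` is the one towards `x` plus the edge value as soon as
direction `μ` has been traversed: the legs in the directions `> μ` are empty. [folklore] -/
theorem axPrim_add_gen_of_comb (θ : Λ → Fin d → A) (x : Λ) (μ : Fin d)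
    (hcomb : ∀ ν : Fin d, μ < ν → F.cval ν x = 0) (hx : F.cval μ x + 1 < F.period μ) :
    ∀ k : ℕ, F.axPrim θ (x + F.gen μ) k = F.axPrim θ x k + (if (μ : ℕ) < k then θ (F.trunc k x) μ else 0)
  | 0 => by simp
  | k + 1 => by
    have IH := axPrim_add_gen_of_comb θ x μ hcomb hx k
    rw [axPrim_succ, axPrim_succ, IH]
    by_cases hkd : k < d
    · simp only [dif_pos hkd]
      rcases lt_trichotomy (μ : ℕ) k with hlt | heq | hgt
      · -- direction `k > μ` is transverse to the comb: both `k`-legs are empty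
        have hμκ' : μ < (⟨k, hkd⟩ : Fin d) := Fin.lt_def.2 hlt
        have hμκ : μ ≠ ⟨k, hkd⟩ := ne_of_lt hμκ'
        have h0 : F.cval ⟨k, hkd⟩ x = 0 := hcomb _ hμκ'
        have h0' : F.cval ⟨k, hkd⟩ (x + F.gen μ) = 0 := by rw [F.cval_add_gen_of_ne x (Ne.symm hμκ), h0]
        have hlt' : (μ : ℕ) < k + 1 := Nat.lt_succ_of_lt hlt
        rw [h0', h0, lineSum_zero, lineSum_zero, add_zero, add_zero, if_pos hlt, if_pos hlt', F.trunc_succ hkd,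
          h0, zero_nsmul, add_zero]
      · -- direction `μ` is direction `k`: one more edge at the end of the `μ`-leg
        have hμκ : μ = ⟨k, hkd⟩ := Fin.ext heq
        subst hμκ
        rw [if_neg (lt_irrefl _), if_pos (Nat.lt_succ_self _), add_zero, F.trunc_add_gen_of_lt k x _ hx,
          if_neg (lt_irrefl _), add_zero, F.cval_add_gen_self_of_lt _ _ hx, lineSum_succ, F.trunc_succ hkd,
          add_assoc]
      · -- direction `μ` not yet traversed: nothing changes
        have hμκ : μ ≠ ⟨k, hkd⟩ := fun h => by rw [h] at hgt; exact lt_irrefl _ hgt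
        have h1 : ¬ (μ : ℕ) < k := by omega
        have h2 : ¬ (μ : ℕ) < k + 1 := by omega
        rw [if_neg h1, if_neg h2, add_zero, add_zero, F.trunc_add_gen_of_lt k x μ hx, if_neg h1, add_zero,
          F.cval_add_gen_of_ne x (Ne.symm hμκ)]
    · -- all directions traversed: both corners are `x` itself
      simp only [dif_neg hkd, add_zero]
      have hdk : d ≤ k := not_lt.1 hkd
      have h2 : (μ : ℕ) < k + 1 := by have := μ.isLt; omega
      have h3 : (μ : ℕ) < k := by have := μ.isLt; omega
      rw [if_pos h3, if_pos h2, F.trunc_of_le hdk, F.trunc_of_le (Nat.le_succ_of_le hdk)]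

variable {F} in
/-- **The axial primitive integrates every cochain on the comb**: `d₀ (prim θ) (x, μ) = θ (x, μ)` on every
comb edge, for an arbitrary (not necessarily flat) `1`-cochain `θ`. [folklore] -/
theorem d₀_prim_of_isCombEdge (θ : Λ → Fin d → A) {x : Λ} {μ : Fin d} (h : F.IsCombEdge x μ) :
    F.d₀ (F.prim θ) x μ = θ x μ := by
  have h' := F.axPrim_add_gen_of_comb θ x μ h.1 h.2 d
  rw [if_pos μ.isLt, F.trunc_of_le le_rfl] at h'
  rw [d₀_apply, prim, prim, h', add_sub_cancel_left]

/-- **A cochain vanishing on the comb has zero axial primitive** (every staircase edge is a comb edge).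
[folklore] -/
theorem prim_eq_zero_of_comb (ρ : Λ → Fin d → A) (hρ : ∀ x μ, F.IsCombEdge x μ → ρ x μ = 0) :
    F.prim ρ = 0 := by
  funext x
  suffices h : ∀ k, F.axPrim ρ x k = 0 from h d
  intro k
  induction k with
  | zero => rfl
  | succ k IH =>
    rw [axPrim_succ, IH, zero_add]
    split_ifs with hkd
    · refine Finset.sum_eq_zero fun j hj => hρ _ _ (F.isCombEdge_add_nsmul_gen ?_ ?_ ?_)
      · intro ν hν
        rw [F.cval_trunc, if_neg]
        have := Fin.lt_def.1 hν
        change k < (ν : ℕ) at this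
        omega
      · rw [F.cval_trunc, if_neg (lt_irrefl _)]
      · have h1 := Finset.mem_range.1 hj
        have h2 := F.cval_lt ⟨k, hkd⟩ x
        omega
    · rfl

/-! ## The comb representative and the decomposition -/

/-- The **comb-gauge representative** of the gauge class of `θ` modulo gradients: `θ - d₀ (prim θ)`.
[folklore] -/
noncomputable def combRep (θ : Λ → Fin d → A) : Λ → Fin d → A := θ - F.d₀ (F.prim θ)

/-- Unfolding `combRep`. [folklore] -/
theorem combRep_apply (θ : Λ → Fin d → A) (x : Λ) (μ : Fin d) :
    F.combRep θ x μ = θ x μ - F.d₀ (F.prim θ) x μ := rfl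

variable {F} in
/-- The comb representative vanishes on the comb. [folklore] -/
theorem combRep_of_isCombEdge (θ : Λ → Fin d → A) {x : Λ} {μ : Fin d} (h : F.IsCombEdge x μ) :
    F.combRep θ x μ = 0 := by
  rw [combRep_apply, d₀_prim_of_isCombEdge θ h, sub_self]

/-- **The comb decomposition**: `θ = d₀ (prim θ) + combRep θ`. [folklore] -/
theorem d₀_prim_add_combRep (θ : Λ → Fin d → A) : F.d₀ (F.prim θ) + F.combRep θ = θ := by
  rw [combRep, add_sub_cancel]

/-- The comb representative has the curl of `θ` (gradients are flat). [folklore] -/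
theorem d₁_combRep (θ : Λ → Fin d → A) : F.d₁ (F.combRep θ) = F.d₁ θ := by
  rw [combRep, d₁_sub, d₁_d₀, sub_zero]

/-- `combRep` is additive. [folklore] -/
theorem combRep_add (θ η : Λ → Fin d → A) : F.combRep (θ + η) = F.combRep θ + F.combRep η := by
  rw [combRep, combRep, combRep, prim_add, d₀_add]; abel

/-- The comb representative of a gradient vanishes. [folklore] -/
theorem combRep_d₀ (f : Λ → A) : F.combRep (F.d₀ f) = 0 := by
  funext x μ
  have h : F.prim (F.d₀ f) = fun y => f y - f 0 := funext (F.prim_d₀ f)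
  rw [combRep_apply, h, d₀_apply, d₀_apply, Pi.zero_apply, Pi.zero_apply]
  abel

/-- The comb representative of a cochain vanishing on the comb is itself. [folklore] -/
theorem combRep_of_comb (ρ : Λ → Fin d → A) (hρ : ∀ x μ, F.IsCombEdge x μ → ρ x μ = 0) :
    F.combRep ρ = ρ := by
  rw [combRep, F.prim_eq_zero_of_comb ρ hρ, d₀_zero, sub_zero]

/-- **Uniqueness of the comb decomposition**: if `θ = d₀ f + ρ` with `f 0 = 0` and `ρ` vanishing on the
comb, then `f = prim θ` and `ρ = combRep θ`. [folklore] -/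
theorem eq_prim_and_eq_combRep {θ : Λ → Fin d → A} {f : Λ → A} {ρ : Λ → Fin d → A} (hf : f 0 = 0)
    (hρ : ∀ x μ, F.IsCombEdge x μ → ρ x μ = 0) (h : θ = F.d₀ f + ρ) :
    f = F.prim θ ∧ ρ = F.combRep θ := by
  have hprim : F.prim θ = f := by
    rw [h, prim_add, F.prim_eq_zero_of_comb ρ hρ, add_zero]
    funext x
    rw [F.prim_d₀, hf, sub_zero]
  refine ⟨hprim.symm, ?_⟩
  rw [combRep, hprim, h, add_sub_cancel_left]

/-! ## The comb decomposition as an additive equivalence -/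

/-- The functions vanishing at the origin, as a subgroup of the `0`-cochains. [folklore] -/
def pinnedFun : AddSubgroup (Λ → A) where
  carrier := {f | f 0 = 0}
  add_mem' := by intro f g hf hg; simp only [Set.mem_setOf_eq, Pi.add_apply] at *; rw [hf, hg, add_zero]
  zero_mem' := rfl
  neg_mem' := by intro f hf; simp only [Set.mem_setOf_eq, Pi.neg_apply] at *; rw [hf, neg_zero]

/-- The `1`-cochains vanishing on the comb, as a subgroup. [folklore] -/
def combVanishing : AddSubgroup (Λ → Fin d → A) where
  carrier := {ρ | ∀ x μ, F.IsCombEdge x μ → ρ x μ = 0}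
  add_mem' := by
    intro ρ ρ' hρ hρ' x μ h
    simp only [Pi.add_apply]
    rw [hρ x μ h, hρ' x μ h, add_zero]
  zero_mem' := fun _ _ _ => rfl
  neg_mem' := by
    intro ρ hρ x μ h
    simp only [Pi.neg_apply]
    rw [hρ x μ h, neg_zero]

/-- Membership in `pinnedFun`. [folklore] -/
@[simp] theorem mem_pinnedFun_iff (f : Λ → A) : f ∈ pinnedFun (Λ := Λ) (A := A) ↔ f 0 = 0 := Iff.rfl

/-- Membership in `combVanishing`. [folklore] -/
@[simp] theorem mem_combVanishing_iff (ρ : Λ → Fin d → A) :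
    ρ ∈ F.combVanishing ↔ ∀ x μ, F.IsCombEdge x μ → ρ x μ = 0 := Iff.rfl

/-- **The comb gauge as an additive equivalence**: `θ ↦ (prim θ, combRep θ)` identifies the `1`-cochains with
pairs (function vanishing at the origin, cochain vanishing on the comb), with inverse `(f, ρ) ↦ d₀ f + ρ`.
[folklore] -/
noncomputable def combEquiv :
    (Λ → Fin d → A) ≃+ (pinnedFun (Λ := Λ) (A := A)) × F.combVanishing (A := A) where
  toFun θ := (⟨F.prim θ, F.prim_origin θ⟩, ⟨F.combRep θ, fun _ _ h => combRep_of_isCombEdge θ h⟩)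
  invFun p := F.d₀ (p.1 : Λ → A) + (p.2 : Λ → Fin d → A)
  left_inv θ := F.d₀_prim_add_combRep θ
  right_inv p := by
    obtain ⟨hf, hρ⟩ := F.eq_prim_and_eq_combRep (θ := F.d₀ (p.1 : Λ → A) + (p.2 : Λ → Fin d → A))
      p.1.2 p.2.2 rfl
    ext <;> simp [← hf, ← hρ]
  map_add' θ η := by
    ext <;> simp [prim_add, combRep_add]

/-- The forward map of `combEquiv`. [folklore] -/
theorem combEquiv_apply (θ : Λ → Fin d → A) :
    F.combEquiv θ =
      ((⟨F.prim θ, F.prim_origin θ⟩ : pinnedFun (Λ := Λ) (A := A)),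
        (⟨F.combRep θ, fun _ _ h => combRep_of_isCombEdge θ h⟩ : F.combVanishing (A := A))) :=
  rfl

/-- The inverse map of `combEquiv`: `(f, ρ) ↦ d₀ f + ρ`. [folklore] -/
theorem combEquiv_symm_apply (p : (pinnedFun (Λ := Λ) (A := A)) × F.combVanishing (A := A)) :
    (F.combEquiv (A := A)).symm p = F.d₀ (p.1 : Λ → A) + (p.2 : Λ → Fin d → A) :=
  rfl

/-! ## Gauge classes are labelled by curl and winding

The comb representative of `θ` depends only on the gauge class `θ + d₀ C⁰`, and two cochains are gauge
equivalent iff they have the same curl `d₁` and the same winding vector `wind` (by the structure theorem for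
flat cochains, `exists_d₀_eq_iff`).  Hence the cochains vanishing on the comb — the index set of the
regrouped sum over integer bond fields in the Villain / Fröhlich–Spencer unfolding — are in bijection with the
pairs (curl in the image of `d₁`, winding vector): a vortex configuration together with its global
holonomies (`sectorEquiv`). -/

/-- Flatness is the vanishing of the curl as a function: `IsFlat θ ↔ d₁ θ = 0`. [folklore] -/
theorem isFlat_iff_d₁_eq_zero (θ : Λ → Fin d → A) : F.IsFlat θ ↔ F.d₁ θ = 0 := by
  simp only [IsFlat, funext_iff, Pi.zero_apply]

/-- Two cochains differ by a flat cochain iff they have the same curl. [folklore] -/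
theorem isFlat_sub_iff (θ η : Λ → Fin d → A) : F.IsFlat (θ - η) ↔ F.d₁ θ = F.d₁ η := by
  rw [isFlat_iff_d₁_eq_zero, d₁_sub, sub_eq_zero]

/-- The winding vector is gauge invariant: `wind (combRep θ) = wind θ`. [folklore] -/
@[simp] theorem wind_combRep (θ : Λ → Fin d → A) : F.wind (F.combRep θ) = F.wind θ := by
  rw [combRep, wind_sub, wind_d₀, sub_zero]

/-- `combRep` is compatible with subtraction. [folklore] -/
theorem combRep_sub (θ η : Λ → Fin d → A) : F.combRep (θ - η) = F.combRep θ - F.combRep η :=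
  eq_sub_of_add_eq (by rw [← combRep_add, sub_add_cancel])

/-- The comb representative of a seam cochain is itself plus nothing from the comb: more precisely seam
cochains need not vanish on the comb, but their comb representative has the same winding vector,
`wind (combRep (seam w)) = w`. [folklore] -/
theorem wind_combRep_seam (w : Fin d → A) : F.wind (F.combRep (F.seam w)) = w := by
  rw [wind_combRep, wind_seam]

/-- `combRep θ = 0` iff `θ` is the gradient of its axial primitive. [folklore] -/
theorem combRep_eq_zero_iff (θ : Λ → Fin d → A) : F.combRep θ = 0 ↔ θ = F.d₀ (F.prim θ) := by
  rw [combRep, sub_eq_zero]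

/-- `combRep θ = 0` iff `θ` is a gradient. [folklore] -/
theorem combRep_eq_zero_iff_exists (θ : Λ → Fin d → A) :
    F.combRep θ = 0 ↔ ∃ f : Λ → A, θ = F.d₀ f := by
  refine ⟨fun h => ⟨F.prim θ, (F.combRep_eq_zero_iff θ).1 h⟩, ?_⟩
  rintro ⟨f, rfl⟩
  exact F.combRep_d₀ f

/-- **Gradients are exactly the curl-free cochains with zero winding**, comb-gauge form:
`combRep θ = 0 ↔ IsFlat θ ∧ wind θ = 0`. [folklore] -/
theorem combRep_eq_zero_iff_isFlat (θ : Λ → Fin d → A) :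
    F.combRep θ = 0 ↔ F.IsFlat θ ∧ F.wind θ = 0 := by
  rw [combRep_eq_zero_iff_exists, exists_d₀_eq_iff]

/-- **Gauge classes are labelled by curl and winding**: two cochains have the same comb representative iff
they have the same curl and the same winding vector. [folklore: Fröhlich–Spencer, CMP 81 (1981) §3] -/
theorem combRep_eq_combRep_iff (θ η : Λ → Fin d → A) :
    F.combRep θ = F.combRep η ↔ F.d₁ θ = F.d₁ η ∧ F.wind θ = F.wind η := by
  rw [← sub_eq_zero, ← combRep_sub, combRep_eq_zero_iff_isFlat, isFlat_sub_iff, wind_sub, sub_eq_zero]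

variable {F} in
/-- **A cochain vanishing on the comb is determined by its curl and its winding vector.** [folklore] -/
theorem eq_of_comb_of_d₁_eq_of_wind_eq {ρ ρ' : Λ → Fin d → A}
    (hρ : ∀ x μ, F.IsCombEdge x μ → ρ x μ = 0) (hρ' : ∀ x μ, F.IsCombEdge x μ → ρ' x μ = 0)
    (hd : F.d₁ ρ = F.d₁ ρ') (hw : F.wind ρ = F.wind ρ') : ρ = ρ' := by
  rw [← F.combRep_of_comb ρ hρ, ← F.combRep_of_comb ρ' hρ', combRep_eq_combRep_iff]
  exact ⟨hd, hw⟩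

/-- **Every curl and every winding vector is realised in the comb gauge** (curl part): the comb
representative of `θ + seam (w - wind θ)` has the curl of `θ`. [folklore] -/
theorem d₁_combRep_add_seam (θ : Λ → Fin d → A) (w : Fin d → A) :
    F.d₁ (F.combRep (θ + F.seam (w - F.wind θ))) = F.d₁ θ := by
  rw [d₁_combRep, d₁_add, d₁_seam, add_zero]

/-- **Every curl and every winding vector is realised in the comb gauge** (winding part): the comb
representative of `θ + seam (w - wind θ)` has winding vector `w`. [folklore] -/
theorem wind_combRep_add_seam (θ : Λ → Fin d → A) (w : Fin d → A) :
    F.wind (F.combRep (θ + F.seam (w - F.wind θ))) = w := by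
  rw [wind_combRep, wind_add, wind_seam, add_sub_cancel]

/-! ## The vortex-sector labelling as an equivalence -/

/-- The **curls**: the `2`-cochains in the image of `d₁`, as a subgroup. [folklore] -/
def curlImage : AddSubgroup (Λ → Fin d → Fin d → A) where
  carrier := {q | ∃ θ : Λ → Fin d → A, F.d₁ θ = q}
  add_mem' := by
    rintro q q' ⟨θ, rfl⟩ ⟨θ', rfl⟩
    exact ⟨θ + θ', F.d₁_add θ θ'⟩
  zero_mem' := ⟨0, F.d₁_zero⟩
  neg_mem' := by
    rintro q ⟨θ, rfl⟩
    exact ⟨-θ, F.d₁_neg θ⟩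

/-- Membership in `curlImage`. [folklore] -/
@[simp] theorem mem_curlImage_iff (q : Λ → Fin d → Fin d → A) :
    q ∈ F.curlImage (A := A) ↔ ∃ θ : Λ → Fin d → A, F.d₁ θ = q := Iff.rfl

/-- The curl of any cochain lies in `curlImage`. [folklore] -/
theorem d₁_mem_curlImage (θ : Λ → Fin d → A) : F.d₁ θ ∈ F.curlImage (A := A) := ⟨θ, rfl⟩

/-- The comb-gauge cochain with prescribed curl class `q` and winding vector `w`:
`combRep (θ_q + seam (w - wind θ_q))` for a chosen preimage `θ_q` of `q`. [folklore] -/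
noncomputable def sectorRep (q : F.curlImage (A := A)) (w : Fin d → A) : Λ → Fin d → A :=
  F.combRep (q.2.choose + F.seam (w - F.wind q.2.choose))

/-- `sectorRep q w` vanishes on the comb. [folklore] -/
theorem sectorRep_of_isCombEdge (q : F.curlImage (A := A)) (w : Fin d → A) {x : Λ} {μ : Fin d}
    (h : F.IsCombEdge x μ) : F.sectorRep q w x μ = 0 :=
  combRep_of_isCombEdge _ h

/-- `sectorRep q w` has curl `q`. [folklore] -/
@[simp] theorem d₁_sectorRep (q : F.curlImage (A := A)) (w : Fin d → A) :
    F.d₁ (F.sectorRep q w) = (q : Λ → Fin d → Fin d → A) := by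
  rw [sectorRep, d₁_combRep_add_seam]
  exact q.2.choose_spec

/-- `sectorRep q w` has winding vector `w`. [folklore] -/
@[simp] theorem wind_sectorRep (q : F.curlImage (A := A)) (w : Fin d → A) :
    F.wind (F.sectorRep q w) = w := by
  rw [sectorRep, wind_combRep_add_seam]

/-- **The vortex-sector labelling.** The map `ρ ↦ (d₁ ρ, wind ρ)` is an additive equivalence from the
cochains vanishing on the comb onto (curls) × (winding vectors), with inverse `sectorRep`: the gauge
classes of integer bond fields are exactly the pairs (vortex configuration, global holonomies).
[folklore: Fröhlich–Spencer, CMP 81 (1981) §3] -/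
noncomputable def sectorEquiv :
    F.combVanishing (A := A) ≃+ F.curlImage (A := A) × (Fin d → A) where
  toFun ρ := (⟨F.d₁ (ρ : Λ → Fin d → A), F.d₁_mem_curlImage _⟩, F.wind (ρ : Λ → Fin d → A))
  invFun p := ⟨F.sectorRep p.1 p.2, fun _ _ h => F.sectorRep_of_isCombEdge p.1 p.2 h⟩
  left_inv ρ := by
    apply Subtype.ext
    exact eq_of_comb_of_d₁_eq_of_wind_eq (fun _ _ h => F.sectorRep_of_isCombEdge _ _ h) ρ.2
      (F.d₁_sectorRep _ _) (F.wind_sectorRep _ _)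
  right_inv p := by
    refine Prod.ext (Subtype.ext ?_) ?_
    · exact F.d₁_sectorRep p.1 p.2
    · exact F.wind_sectorRep p.1 p.2
  map_add' ρ ρ' := by
    refine Prod.ext (Subtype.ext ?_) ?_
    · exact F.d₁_add _ _
    · exact F.wind_add _ _

/-- The forward map of `sectorEquiv`: `ρ ↦ (d₁ ρ, wind ρ)`. [folklore] -/
theorem sectorEquiv_apply (ρ : F.combVanishing (A := A)) :
    F.sectorEquiv ρ =
      ((⟨F.d₁ (ρ : Λ → Fin d → A), F.d₁_mem_curlImage _⟩ : F.curlImage (A := A)),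
        F.wind (ρ : Λ → Fin d → A)) :=
  rfl

/-- The inverse map of `sectorEquiv` is `sectorRep`. [folklore] -/
theorem sectorEquiv_symm_apply (p : F.curlImage (A := A) × (Fin d → A)) :
    ((F.sectorEquiv (A := A)).symm p : Λ → Fin d → A) = F.sectorRep p.1 p.2 :=
  rfl

/-- **Counting form of the labelling**: a cochain vanishing on the comb with curl `q` and winding vector
`w` is `sectorRep q w`; in particular there is exactly one such cochain. [folklore] -/
theorem eq_sectorRep_of_comb {ρ : Λ → Fin d → A} (hρ : ∀ x μ, F.IsCombEdge x μ → ρ x μ = 0)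
    (w : Fin d → A) (hw : F.wind ρ = w) :
    ρ = F.sectorRep ⟨F.d₁ ρ, F.d₁_mem_curlImage ρ⟩ w :=
  eq_of_comb_of_d₁_eq_of_wind_eq hρ (fun _ _ h => F.sectorRep_of_isCombEdge _ _ h)
    (by rw [d₁_sectorRep]) (by rw [wind_sectorRep, hw])

end TorusChart

end Literature.MathematicalPhysics.QuantumFieldTheory
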